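import Mathlib
import HarnessLib
import Summits.HubbardSuperconductivity.HubbardSuperconductivity.Theorems.KLProgrammeKLRegimeSectorSliceDefectRatePack
import Summits.HubbardSuperconductivity.HubbardSuperconductivity.Theorems.KLProgrammeKLRegimeTwoVolumeSliceFrameDefect
import Summits.HubbardSuperconductivity.HubbardSuperconductivity.Theorems.KLProgrammeKLRegimeSectorSliceGramFat

/-!
# Route `KLProgramme` — VL child `KLRegimeVolumeLimitV17F2` (stmt-HubbardSuperconductivity-20440), closer MODEL file M2 «MISMATCH-SLICE», brackets (a)(b),
# RATE FORM, part 2: the plain rows / columns of the sectorised slice-covariance frame defect are `≤ C·(M/β)·ε`, `C` free of `(L, M, K, K′, ε)`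

Cell `gate-hubbard-kl`, seat hubbard-kl-k3c4-p2 (g13; UV / Matsubara all-U lane); WANT (w7) of the VL registrant k3c4-p1 g12 (KL STATUS 2026-08-28 00:32Z):
the `cR/cC` of the response bracket `sum_norm_kernel_effAction_add_sub_le_response_of_gramBounded` for the symbol-defect part
`S(F̃_m[K])ᵀ·(C^{K′}_{(Λ,Λ′]} − C^{K}_{(Λ,Λ′]})·S(F̃_m[K])` of the two top frames' slice covariance, in the `∃C`-before-`(L, M, K, K′, ε)` shape of
`exists_overlapDefect_rate_of_frames` (p587829).  `…SectorSliceDefectRowsFat` (p580272) gives the rows at free rates; part 1 (`…SectorSliceDefectRateAlgebra`,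
`…SectorSliceDefectRateCore`, `…SectorSliceDefectRatePack`) does the `(L, M)`-bookkeeping at the canonical rates `s₀ = 1/(2M)`, `s₁ = s₂ = s₃ = s₃′ = 1`, `Nr = 2`, `R₀ = 0` once and for all.

* **`exists_sliceDefect_rate`** — for the fixed one-volume data (band `B`, frame `C²/C³` sizes `A, A₃`, angular data `Ba, Ba3`, cutoff data `d, B₁…B₄`,
  slice `Λ ≤ Λ′`, band-derivative sizes `K₁ K₂ K₃`, scale `m`, `β`) there is `C ≥ 0` such that for ALL `L, M ≥ 1`, all frames `K, K′` with those
  sizes, under the eventual conditions `Λ_m β < π(2M−5)`, `Λ′ < π(2M−5)/β`, `(15/2)|2π/L| ≤ z`, and every `ε ∈ [0,1]` with `coeffNorm j (K′ ⊖ K) ≤ ε`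
  (`j ≤ 3`): `Σ_{Y′} ‖E Y Y′‖ ≤ C·(M/β)·ε` and `Σ_Y ‖E Y Y′‖ ≤ C·(M/β)·ε`.  The factor `M/β` is the grid density of the space-time lattice carried by
  every plain covariance row of the tree (`alphaWt … ≤ Cα·(M/β)/Λ`); it is NOT an artefact (the rows of a fixed slice grow like the number of time
  slices per unit time); the `M`-free datum is the entry sup (`sE`), filed separately.
Proofs only; no definitions, no named facts. [folklore] BGM 2006 §2.7 (2.66)–(2.71a), §2.8 (2.81), §3 (3.2)–(3.8).
-/

noncomputable section

namespace Summit.HubbardSuperconductivity.HubbardSuperconductivity.Theorems.TorusFourierL2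

set_option linter.dupNamespace false -- summit = problem name (single-conjunct summit), D-0017

open Set Finset Literature.MathematicalPhysics.QuantumLattice Literature.MathematicalPhysics.QuantumLattice.BandSectorCounting
open Literature.MathematicalPhysics.QuantumLattice.FermiRG Literature.Probability.LatticeModels Literature.Analysis.SpecialFunctions
open Summit.HubbardSuperconductivity.HubbardSuperconductivity.Theorems.DispersionFlow
open Summit.HubbardSuperconductivity.HubbardSuperconductivity.Theorems.KLRegimeSplit
open Summit.HubbardSuperconductivity.HubbardSuperconductivity.Theorems.KLProgrammeLegKernels
open Summit.HubbardSuperconductivity.HubbardSuperconductivity.Theorems.PerturbedFermiCurve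
open Summit.HubbardSuperconductivity.HubbardSuperconductivity.Theorems.EngineV8
open Summit.HubbardSuperconductivity.HubbardSuperconductivity.Theorems.TwoPointAssembly
open scoped Real Nat

/-- `(2M+1)/β ≤ 3·(M/β)` for `M ≥ 1`, `β > 0` (the last numeral of the rate form). [folklore] -/
theorem two_mul_add_one_div_le {M : ℕ} (hM : 0 < M) {β : ℝ} (hβ : 0 < β) :
    (((2 * M : ℕ) : ℝ) + 1) / β ≤ 3 * ((M : ℝ) / β) := by
  have hM1 : (1 : ℝ) ≤ M := by exact_mod_cast hM
  rw [mul_div_assoc', div_le_div_iff_of_pos_right hβ]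
  push_cast; linarith

section Frames

open Classical

variable {a b : ℝ} (B : BandBounds a b) {A μ e₀ z β : ℝ} (hADt : 2 * A < B.Dtmin)
  (he : 0 < e₀) (hz : 0 < z) (hz1 : z ≤ 1) (hgap : e₀ + A + z ^ 2 < -μ) (h3 : e₀ + A - μ ≤ 3)
  (hlo : a ≤ μ - A - e₀) (hhi : μ + A + e₀ ≤ b) (hβ : 0 < β) (hρA : 4 * A < 2 * B.rhomin) (m : ℕ)
  {d : ℝ} (hd : 0 ≤ d) (hd1 : ∀ u, |deriv (bgmCutoffSq e₀) u| ≤ d) (hd2 : ∀ u, |iteratedDeriv 2 (bgmCutoffSq e₀) u| ≤ d)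
  (hd3 : ∀ u, |iteratedDeriv 3 (bgmCutoffSq e₀) u| ≤ d)
  {A₃ a₃ : ℝ} (ha3 : A₃ * klScale e₀ m ^ 2 ≤ a₃)
  {Ba : ℝ} (hB0 : 0 ≤ Ba)
  (hB : ∀ (i : ℕ), i ≤ 2 → ∀ (n : ℕ) (ω : ℤ) (θ₀ : ℝ) (q w : Fin 2 → ℝ) (t : ℝ) {r₀ : ℝ}, 0 < r₀ →
    r₀ ≤ ‖momToComplex (q + t • w)‖ → |sectorRelAngle θ₀ (q + t • w)| < π →
    ‖iteratedDeriv i (fun t : ℝ => sectorWeightCirc n ω (polarAngle (q + t • w))) t‖ ≤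
      (2 : ℕ)! * Ba * ((1 + (sectorWidth n)⁻¹ * (2 : ℕ)!) * ‖momToComplex w‖ / r₀) ^ i)
  {Ba3 : ℝ} (hB30 : 0 ≤ Ba3)
  (hB3 : ∀ (i : ℕ), i ≤ 3 → ∀ (n : ℕ) (ω : ℤ) (θ₀ : ℝ) (q w : Fin 2 → ℝ) (t : ℝ) {r₀ : ℝ}, 0 < r₀ →
    r₀ ≤ ‖momToComplex (q + t • w)‖ → |sectorRelAngle θ₀ (q + t • w)| < π →
    ‖iteratedDeriv i (fun t : ℝ => sectorWeightCirc n ω (polarAngle (q + t • w))) t‖ ≤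
      (3 : ℕ)! * Ba3 * ((1 + (sectorWidth n)⁻¹ * (3 : ℕ)!) * ‖momToComplex w‖ / r₀) ^ i)
  {Λ Λ' : ℝ} (hΛ : 0 < Λ) (hΛΛ' : Λ ≤ Λ') {K₁ K₂ K₃ : ℝ} (hK₁0 : 0 ≤ K₁) (hK₂0 : 0 ≤ K₂) (hK₃0 : 0 ≤ K₃)
  {B₁ B₂ B₃ B₄ : ℝ} (hB₁ : ∀ x, |deriv salmhoferCutoff x| ≤ B₁) (hB₂ : ∀ x, |deriv (deriv salmhoferCutoff) x| ≤ B₂)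
  (hB₃ : ∀ x, |deriv (deriv (deriv salmhoferCutoff)) x| ≤ B₃) (hB₄ : ∀ x, |deriv (deriv (deriv (deriv salmhoferCutoff))) x| ≤ B₄)

include B hADt he hz hz1 hgap h3 hlo hhi hβ hρA hd hd1 hd2 hd3 ha3 hB0 hB hB30 hB3 hΛ hΛΛ' hK₁0 hK₂0 hK₃0 hB₁ hB₂ hB₃ hB₄

set_option maxHeartbeats 400000 in -- one call of p580272 with its 70 arguments plus the rate core: ≈ 1.5× the default budget
/-- **THE PLAIN ROWS / COLUMNS OF THE SECTORISED SLICE-COVARIANCE FRAME DEFECT ARE `O((M/β)·ε)`, UNIFORMLY IN `(L, M, K, K′)`.**  See the module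
docstring. [cite: BenfattoGiulianiMastropietro2006, §2.8 (2.81); §3 (3.3)] -/
theorem exists_sliceDefect_rate :
    ∃ C : ℝ, 0 ≤ C ∧ ∀ (L M : ℕ) [NeZero L] [NeZero M] (K K' : TrigPolyC4v),
      (∀ p : Momentum, ∀ j ≤ 2, ‖iteratedFDeriv ℝ j (frameShift K) p‖ ≤ A) →
      (∀ p : Momentum, ‖iteratedFDeriv ℝ 3 (frameShift K) p‖ ≤ A₃) →
      (∀ p, ‖fderiv ℝ (frameLevel μ K) p‖ ≤ K₁) → (∀ p, ‖iteratedFDeriv ℝ 2 (frameLevel μ K) p‖ ≤ K₂) →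
      (∀ p, ‖iteratedFDeriv ℝ 3 (frameLevel μ K) p‖ ≤ K₃) →
      klScale e₀ m * β < π * (2 * M - 5) → Λ' < π * (2 * M - 5) / β → 3 * |2 * π / (L : ℝ)| * (2 + 1 / 2) ≤ z →
      ∀ ε : ℝ, 0 ≤ ε → ε ≤ 1 → (∀ j ≤ 3, (fsub K' K).coeffNorm j ≤ ε) →
        (∀ Y : SpaceTimeIdx L M × SectorLeg (sectorCount (m + 1)),
          ∑ Y' : SpaceTimeIdx L M × SectorLeg (sectorCount (m + 1)), ‖((sectorSubMatrix L M β (bgmFatMultiplier L M e₀ β (nambuXiCT L μ K) (m + 1))).transpose *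
            (hubbardCovSliceCT L M β μ 0 K' Λ Λ' - hubbardCovSliceCT L M β μ 0 K Λ Λ') *
            sectorSubMatrix L M β (bgmFatMultiplier L M e₀ β (nambuXiCT L μ K) (m + 1))) Y Y'‖ ≤ C * ((M : ℝ) / β) * ε) ∧
        (∀ Y' : SpaceTimeIdx L M × SectorLeg (sectorCount (m + 1)),
          ∑ Y : SpaceTimeIdx L M × SectorLeg (sectorCount (m + 1)), ‖((sectorSubMatrix L M β (bgmFatMultiplier L M e₀ β (nambuXiCT L μ K) (m + 1))).transpose *
            (hubbardCovSliceCT L M β μ 0 K' Λ Λ' - hubbardCovSliceCT L M β μ 0 K Λ Λ') *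
            sectorSubMatrix L M β (bgmFatMultiplier L M e₀ β (nambuXiCT L μ K) (m + 1))) Y Y'‖ ≤ C * ((M : ℝ) / β) * ε) := by
  -- the fixed abbreviations
  have hDt : 0 < B.Dtmin - 2 * A := by linarith
  have hΛm : 0 < klScale e₀ m := by rw [klScale]; positivity
  obtain ⟨ρf, hρf⟩ : ∃ x : ℝ, x = (klScale e₀ m + B.smax * B.Dtmin * (3 * sectorWidth (m + 1) / 4)) / (B.Dtmin - 2 * A) +
    π * Real.sqrt 2 * (1 + (4 + 2 * A) / (B.Dtmin - 2 * A)) * sectorWidth (m + 1) := ⟨_, rfl⟩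
  obtain ⟨G₁, hG₁⟩ : ∃ x : ℝ, x = d * e₀ ^ 2 * 1 + 1 * (d * e₀ ^ 2) := ⟨_, rfl⟩
  obtain ⟨G₂, hG₂⟩ : ∃ x : ℝ, x = d * e₀ ^ 4 * 1 + 2 * (d * e₀ ^ 2) * (d * e₀ ^ 2) + 1 * (d * e₀ ^ 4) := ⟨_, rfl⟩
  obtain ⟨G₃, hG₃⟩ : ∃ x : ℝ, x = d * e₀ ^ 6 * 1 + 3 * (d * e₀ ^ 4) * (d * e₀ ^ 2) + 3 * (d * e₀ ^ 2) * (d * e₀ ^ 4) + 1 * (d * e₀ ^ 6) := ⟨_, rfl⟩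
  obtain ⟨κ₃F, hκ₃F⟩ : ∃ x : ℝ, x = (8 * G₃ + 12 * G₂) * (4 + 2 * A) ^ 3 + (12 * G₂ + 6 * G₁) * (4 + 2 * A) * (4 + 4 * A) * e₀ +
      2 * G₁ * (4 * e₀ ^ 2 + 8 * a₃) +
      216 * 9 * Ba3 * ((4 * G₂ + 2 * G₁) * (4 + 2 * A) ^ 2 * (2 * e₀) + 2 * G₁ * (4 + 4 * A) * e₀ * (2 * e₀)) +
      216 * 9 * G₁ * (4 + 2 * A) * (12 * Ba3 + 72 * Ba3 ^ 2) * (2 * e₀) ^ 2 + 216 * 9 * (12 * Ba3 + 216 * Ba3 ^ 2) * (2 * e₀) ^ 3 := ⟨_, rfl⟩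
  obtain ⟨Kp, hKp⟩ : ∃ x : ℝ, x = 4 + 4 * A := ⟨_, rfl⟩
  obtain ⟨wsi, hwsi⟩ : ∃ x : ℝ, x = (sectorWidth (m + 1))⁻¹ := ⟨_, rfl⟩
  obtain ⟨Q, hQ0, hQ⟩ := sliceDefect_rate_core' (klScale e₀ m) Λ β A Ba Kp wsi ρf B.rhomin G₁ G₂ G₃ κ₃F K₁ K₂ K₃ B₁ B₂ B₃ B₄ (1 + klScale klE0 0 * β)
    (xp₀ := (16 * B₁ + 16) / Λ ^ 2) (xp₁ := (32 * B₂ + 144 * B₁ + 128) / Λ ^ 3 * (K₁ + 1) + (16 * B₁ + 16) / Λ ^ 2)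
    (xp₂ := (64 * B₃ + 480 * B₂ + 1728 * B₁ + 1536) / Λ ^ 4 * (K₁ + 1) ^ 2 + (32 * B₂ + 144 * B₁ + 128) / Λ ^ 3 * (2 * K₁ + 1) + ((32 * B₂ + 144 * B₁ + 128) / Λ ^ 3 * (K₂ + 1) + (16 * B₁ + 16) / Λ ^ 2))
    (xp₃ := (128 * B₄ + 1408 * B₃ + 7776 * B₂ + 27648 * B₁ + 24576) / Λ ^ 5 * (K₁ + 1) ^ 3 + (64 * B₃ + 480 * B₂ + 1728 * B₁ + 1536) / Λ ^ 4 * (3 * K₁ ^ 2 + 3 * K₁ + 1) + 3 * ((64 * B₃ + 480 * B₂ + 1728 * B₁ + 1536) / Λ ^ 4 * ((K₁ + 1) * (K₂ + 1)) + (32 * B₂ + 144 * B₁ + 128) / Λ ^ 3 * (K₁ + K₂ + 1)) + ((32 * B₂ + 144 * B₁ + 128) / Λ ^ 3 * (K₃ + 1) + (16 * B₁ + 16) / Λ ^ 2))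
    (tt := 1 * ((2 * π / β) ^ 3 * ((128 * B₄ + 1216 * B₃ + 6912 * B₂ + 26112 * B₁ + 24576) / Λ ^ 5)) + 3 * ((2 * G₁ * |2 * π / β| * 1 / klScale e₀ m) * ((2 * π / β) ^ 2 * ((64 * B₃ + 416 * B₂ + 1600 * B₁ + 1536) / Λ ^ 4))) + 3 * (((4 * G₂ + 2 * G₁) * (2 * π / β) ^ 2 * 1 / klScale e₀ m ^ 2) * ((2 * π / β) * ((32 * B₂ + 128 * B₁ + 128) / Λ ^ 3))) + ((8 * G₃ + 12 * G₂) * |2 * π / β| ^ 3 * 1 / klScale e₀ m ^ 3) * ((16 * B₁ + 16) / Λ ^ 2))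
    (ae1 := 2 * G₁ * ((4 + 2 * A) * (2 * π) + Kp * (ρf + 4 * π) * (2 * π)) / klScale e₀ m + 9 * (4 * Ba * ((1 + 2 * wsi) * (2 * (2 * π)))))
    (ae2 := (4 * G₂ + 2 * G₁) * ((4 + 2 * A) * (2 * π) + Kp * (ρf + 4 * π) * (2 * π)) ^ 2 / klScale e₀ m ^ 2 + 2 * G₁ * (Kp * (2 * π) ^ 2) / klScale e₀ m + 4 * G₁ * ((4 + 2 * A) * (2 * π) + Kp * (ρf + 4 * π) * (2 * π)) / klScale e₀ m * (9 * (4 * Ba * ((1 + 2 * wsi) * (2 * (2 * π))))) + 9 * (4 * Ba * ((1 + 2 * wsi) * (2 * (2 * π))) ^ 2 + 8 * Ba ^ 2 * ((1 + 2 * wsi) * (2 * (2 * π))) ^ 2))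
    (an1 := 2 * G₁ * ((4 + 2 * A) * (5 * π) + Kp * (ρf + 10 * π) * (5 * π)) / klScale e₀ m + 9 * (4 * Ba * ((1 + 2 * wsi) * (2 * (5 * π)))))
    (an2 := (4 * G₂ + 2 * G₁) * ((4 + 2 * A) * (5 * π) + Kp * (ρf + 10 * π) * (5 * π)) ^ 2 / klScale e₀ m ^ 2 + 2 * G₁ * (Kp * (5 * π) ^ 2) / klScale e₀ m + 4 * G₁ * ((4 + 2 * A) * (5 * π) + Kp * (ρf + 10 * π) * (5 * π)) / klScale e₀ m * (9 * (4 * Ba * ((1 + 2 * wsi) * (2 * (5 * π))))) + 9 * (4 * Ba * ((1 + 2 * wsi) * (2 * (5 * π))) ^ 2 + 8 * Ba ^ 2 * ((1 + 2 * wsi) * (2 * (5 * π))) ^ 2))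
    (av1 := 2 * G₁ * ((2 * π) * (4 + 2 * A) + Kp * (ρf + 10 * π) * (5 * π)) / klScale e₀ m + 9 * (4 * Ba * ((1 + 2 * wsi) * (2 * (5 * π)))))
    (av2 := (4 * G₂ + 2 * G₁) * ((2 * π) * (4 + 2 * A) + Kp * (ρf + 10 * π) * (5 * π)) ^ 2 / klScale e₀ m ^ 2 + 2 * G₁ * (Kp * (5 * π) ^ 2) / klScale e₀ m + 4 * G₁ * ((2 * π) * (4 + 2 * A) + Kp * (ρf + 10 * π) * (5 * π)) / klScale e₀ m * (9 * (4 * Ba * ((1 + 2 * wsi) * (2 * (5 * π))))) + 9 * (4 * Ba * ((1 + 2 * wsi) * (2 * (5 * π))) ^ 2 + 8 * Ba ^ 2 * ((1 + 2 * wsi) * (2 * (5 * π))) ^ 2))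
    rfl rfl rfl rfl rfl rfl rfl rfl rfl rfl rfl
  refine ⟨3 * Q, by positivity, ?_⟩
  intro L M _ _ K K' hA hA3 hK₁ hK₂ hK₃ hMm hM' hLz ε hε0 hε1 hε
  -- sizes
  have hMpos : 0 < M := Nat.pos_of_ne_zero (NeZero.ne M)
  have hL : (0 : ℝ) < L := Nat.cast_pos.2 (Nat.pos_of_ne_zero (NeZero.ne L))
  have hL1 : (1 : ℝ) ≤ L := by exact_mod_cast Nat.pos_of_ne_zero (NeZero.ne L)
  have hM21 : (1 : ℝ) ≤ ((2 * M : ℕ) : ℝ) := by exact_mod_cast (show 1 ≤ 2 * M by omega)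
  have hM2 : (0 : ℝ) < ((2 * M : ℕ) : ℝ) := by linarith
  have hA0 : 0 ≤ A := le_trans (norm_nonneg _) (hA 0 0 (by norm_num))
  have hρm : 0 < 2 * B.rhomin - 4 * A := by linarith
  have hB₁0 : 0 ≤ B₁ := (abs_nonneg _).trans (hB₁ 0)
  have hB₂0 : 0 ≤ B₂ := (abs_nonneg _).trans (hB₂ 0)
  have hB₃0 : 0 ≤ B₃ := (abs_nonneg _).trans (hB₃ 0)
  have hB₄0 : 0 ≤ B₄ := (abs_nonneg _).trans (hB₄ 0)
  have hρf0 : 0 ≤ ρf := by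
    rw [hρf]; have := B.smax_pos; have := B.Dtmin_pos; have := sectorWidth_pos (m + 1); positivity
  have hKp0 : 0 ≤ Kp := by rw [hKp]; positivity
  have hwsi0 : 0 ≤ wsi := by rw [hwsi]; have := sectorWidth_pos (m + 1); positivity
  have hG₁0 : 0 ≤ G₁ := by rw [hG₁]; positivity
  have hG₂0 : 0 ≤ G₂ := by rw [hG₂]; positivity
  have hG₃0 : 0 ≤ G₃ := by rw [hG₃]; positivity
  have ha30 : 0 ≤ a₃ := le_trans (by have := le_trans (norm_nonneg _) (hA3 0); positivity) ha3
  have hκ₃F0 : 0 ≤ κ₃F := by rw [hκ₃F]; positivity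
  have hD0 : 0 ≤ 1 + klScale klE0 0 * β := by have := klth_klScale_pos 0; positivity
  -- the canonical rates and their side conditions
  have hs₀ : (0 : ℝ) < 1 / ((2 * M : ℕ) : ℝ) := by positivity
  have hNr : (2 : ℝ) ≤ 2 := le_rfl
  have hR₀ : 2 * (2 * (2 : ℝ) + 1) * ((0 : ℕ) : ℝ) < L := by simpa using hL
  have hkl0 : 0 ≤ klScale klE0 0 * β := (mul_pos (klth_klScale_pos 0) hβ).le
  have hD : (1 : ℝ) ≤ 1 + klScale klE0 0 * β := le_add_of_nonneg_right hkl0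
  have hdom₀ : klScale klE0 0 * β / (2 * M) ≤ (1 + klScale klE0 0 * β) * (1 / ((2 * M : ℕ) : ℝ)) := by
    push_cast
    rw [mul_one_div]
    exact div_le_div_of_nonneg_right (le_add_of_nonneg_left zero_le_one) (by positivity)
  have hdom₁ : klScale klE0 0 ≤ (1 + klScale klE0 0 * β) * 1 := by
    rw [mul_one]
    have h := klScale_klE0_le_klE0 0
    have h' : klE0 ≤ 1 := by norm_num [klE0]
    exact (h.trans h').trans hD
  -- the increment data at `P ≡ ε`
  obtain ⟨hv₀, hv₁, hv₂, hv₃⟩ := incrementData_of_coeffNorm' μ K K' (hε 0 (by norm_num)) (hε 1 (by norm_num)) (hε 2 (by norm_num)) (hε 3 (by norm_num))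
  -- the per-instance abbreviations
  obtain ⟨ℓ₁, hℓ₁⟩ : ∃ x : ℝ, x = 2 * π / (L : ℝ) := ⟨_, rfl⟩
  obtain ⟨ℓ, hℓ⟩ : ∃ x : ℝ, x = 2 * π / (L : ℝ) * (2 + 1 / 2) := ⟨_, rfl⟩
  obtain ⟨τt, hτt⟩ : ∃ x : ℝ, x = |2 * π / L| * (4 + 2 * A) + K₂ * (Real.sqrt 2 * ρf) * (Real.sqrt 2 * ℓ) := ⟨_, rfl⟩
  obtain ⟨Ae1, hAe1⟩ : ∃ x : ℝ, x = 2 * G₁ * ((4 + 2 * A) * ℓ₁ + Kp * (ρf + 2 * ℓ₁) * ℓ₁) / klScale e₀ m * 1 + 1 * 1 * (9 * (4 * Ba * ((1 + 2 * wsi) * (2 * ℓ₁)))) := ⟨_, rfl⟩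
  obtain ⟨Ae2, hAe2⟩ : ∃ x : ℝ, x = ((4 * G₂ + 2 * G₁) * ((4 + 2 * A) * ℓ₁ + Kp * (ρf + 2 * ℓ₁) * ℓ₁) ^ 2 / klScale e₀ m ^ 2 + 2 * G₁ * (Kp * ℓ₁ ^ 2) / klScale e₀ m) * 1 +
    4 * G₁ * ((4 + 2 * A) * ℓ₁ + Kp * (ρf + 2 * ℓ₁) * ℓ₁) / klScale e₀ m * (9 * (4 * Ba * ((1 + 2 * wsi) * (2 * ℓ₁)))) +
    1 * 1 * (9 * (4 * Ba * ((1 + 2 * wsi) * (2 * ℓ₁)) ^ 2 + 8 * Ba ^ 2 * ((1 + 2 * wsi) * (2 * ℓ₁)) ^ 2)) := ⟨_, rfl⟩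
  obtain ⟨An1, hAn1⟩ : ∃ x : ℝ, x = 2 * G₁ * ((4 + 2 * A) * ℓ + Kp * (ρf + 2 * ℓ) * ℓ) / klScale e₀ m * 1 + 1 * 1 * (9 * (4 * Ba * ((1 + 2 * wsi) * (2 * ℓ)))) := ⟨_, rfl⟩
  obtain ⟨An2, hAn2⟩ : ∃ x : ℝ, x = ((4 * G₂ + 2 * G₁) * ((4 + 2 * A) * ℓ + Kp * (ρf + 2 * ℓ) * ℓ) ^ 2 / klScale e₀ m ^ 2 + 2 * G₁ * (Kp * ℓ ^ 2) / klScale e₀ m) * 1 +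
    4 * G₁ * ((4 + 2 * A) * ℓ + Kp * (ρf + 2 * ℓ) * ℓ) / klScale e₀ m * (9 * (4 * Ba * ((1 + 2 * wsi) * (2 * ℓ)))) +
    1 * 1 * (9 * (4 * Ba * ((1 + 2 * wsi) * (2 * ℓ)) ^ 2 + 8 * Ba ^ 2 * ((1 + 2 * wsi) * (2 * ℓ)) ^ 2)) := ⟨_, rfl⟩
  obtain ⟨Av1, hAv1⟩ : ∃ x : ℝ, x = 2 * G₁ * (|2 * π / L| * (4 + 2 * A) + Kp * (ρf + 2 * ℓ) * ℓ) / klScale e₀ m * 1 + 1 * 1 * (9 * (4 * Ba * ((1 + 2 * wsi) * (2 * ℓ)))) := ⟨_, rfl⟩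
  obtain ⟨Av2, hAv2⟩ : ∃ x : ℝ, x = ((4 * G₂ + 2 * G₁) * (|2 * π / L| * (4 + 2 * A) + Kp * (ρf + 2 * ℓ) * ℓ) ^ 2 / klScale e₀ m ^ 2 + 2 * G₁ * (Kp * ℓ ^ 2) / klScale e₀ m) * 1 +
    4 * G₁ * (|2 * π / L| * (4 + 2 * A) + Kp * (ρf + 2 * ℓ) * ℓ) / klScale e₀ m * (9 * (4 * Ba * ((1 + 2 * wsi) * (2 * ℓ)))) +
    1 * 1 * (9 * (4 * Ba * ((1 + 2 * wsi) * (2 * ℓ)) ^ 2 + 8 * Ba ^ 2 * ((1 + 2 * wsi) * (2 * ℓ)) ^ 2)) := ⟨_, rfl⟩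
  obtain ⟨X₀, hX₀⟩ : ∃ x : ℝ, x = (16 * B₁ + 16) * (β * (L : ℝ) ^ 2) / Λ ^ 2 * ε := ⟨_, rfl⟩
  obtain ⟨X₁, hX₁⟩ : ∃ x : ℝ, x = (32 * B₂ + 144 * B₁ + 128) * (β * (L : ℝ) ^ 2) / Λ ^ 3 * ε * (K₁ + ε) + (16 * B₁ + 16) * (β * (L : ℝ) ^ 2) / Λ ^ 2 * ε := ⟨_, rfl⟩
  obtain ⟨X₂, hX₂⟩ : ∃ x : ℝ, x = (64 * B₃ + 480 * B₂ + 1728 * B₁ + 1536) * (β * (L : ℝ) ^ 2) / Λ ^ 4 * ε * (K₁ + ε) ^ 2 +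
    (32 * B₂ + 144 * B₁ + 128) * (β * (L : ℝ) ^ 2) / Λ ^ 3 * (ε * (2 * K₁ + ε)) +
    ((32 * B₂ + 144 * B₁ + 128) * (β * (L : ℝ) ^ 2) / Λ ^ 3 * ε * (K₂ + ε) + (16 * B₁ + 16) * (β * (L : ℝ) ^ 2) / Λ ^ 2 * ε) := ⟨_, rfl⟩
  obtain ⟨X₃, hX₃⟩ : ∃ x : ℝ, x = (128 * B₄ + 1408 * B₃ + 7776 * B₂ + 27648 * B₁ + 24576) * (β * (L : ℝ) ^ 2) / Λ ^ 5 * ε * (K₁ + ε) ^ 3 +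
    (64 * B₃ + 480 * B₂ + 1728 * B₁ + 1536) * (β * (L : ℝ) ^ 2) / Λ ^ 4 * (ε * (3 * K₁ ^ 2 + 3 * K₁ * ε + ε ^ 2)) +
    3 * ((64 * B₃ + 480 * B₂ + 1728 * B₁ + 1536) * (β * (L : ℝ) ^ 2) / Λ ^ 4 * ε * ((K₁ + ε) * (K₂ + ε)) +
      (32 * B₂ + 144 * B₁ + 128) * (β * (L : ℝ) ^ 2) / Λ ^ 3 * (K₁ * ε + ε * K₂ + ε * ε)) +
    ((32 * B₂ + 144 * B₁ + 128) * (β * (L : ℝ) ^ 2) / Λ ^ 3 * ε * (K₃ + ε) + (16 * B₁ + 16) * (β * (L : ℝ) ^ 2) / Λ ^ 2 * ε) := ⟨_, rfl⟩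
  obtain ⟨Tt, hTt⟩ : ∃ x : ℝ, x = (1 / (β * (L : ℝ) ^ 2)) ^ 2 *
    (1 * ((2 * π / β) ^ 3 * ((128 * B₄ + 1216 * B₃ + 6912 * B₂ + 26112 * B₁ + 24576) * (β * (L : ℝ) ^ 2) / Λ ^ 5 * ε)) +
      3 * ((2 * G₁ * |2 * π / β| * 1 / klScale e₀ m) * ((2 * π / β) ^ 2 * ((64 * B₃ + 416 * B₂ + 1600 * B₁ + 1536) * (β * (L : ℝ) ^ 2) / Λ ^ 4 * ε))) +
      3 * (((4 * G₂ + 2 * G₁) * (2 * π / β) ^ 2 * 1 / klScale e₀ m ^ 2) * ((2 * π / β) * ((32 * B₂ + 128 * B₁ + 128) * (β * (L : ℝ) ^ 2) / Λ ^ 3 * ε))) +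
      ((8 * G₃ + 12 * G₂) * |2 * π / β| ^ 3 * 1 / klScale e₀ m ^ 3) * ((16 * B₁ + 16) * (β * (L : ℝ) ^ 2) / Λ ^ 2 * ε)) := ⟨_, rfl⟩
  obtain ⟨AΔ, hAΔ⟩ : ∃ x : ℝ, x = (1 / (β * (L : ℝ) ^ 2)) ^ 2 * X₀ + Tt / (4 / ((1 / ((2 * M : ℕ) : ℝ)) * (2 * M : ℕ))) ^ 3 +
      (1 / (β * (L : ℝ) ^ 2)) ^ 2 * ((Real.sqrt 2 * ℓ₁) ^ 3 * X₃ + 3 * (Ae1 * ((Real.sqrt 2 * ℓ₁) ^ 2 * X₂)) +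
        3 * (Ae2 * ((Real.sqrt 2 * ℓ₁) * X₁)) + κ₃F * ℓ₁ ^ 3 / klScale e₀ m ^ 3 * X₀) / (4 / (1 * L)) ^ 3 +
      (1 / (β * (L : ℝ) ^ 2)) ^ 2 * ((Real.sqrt 2 * ℓ) ^ 3 * X₃ + 3 * (An1 * ((Real.sqrt 2 * ℓ) ^ 2 * X₂)) +
        3 * (An2 * ((Real.sqrt 2 * ℓ) * X₁)) + κ₃F * ℓ ^ 3 / klScale e₀ m ^ 3 * X₀) / (4 / (1 * L)) ^ 3 +
      (1 / (β * (L : ℝ) ^ 2)) ^ 2 * ((Real.sqrt 2 * ℓ) ^ 2 * X₂ + 2 * (Av1 * ((Real.sqrt 2 * ℓ) * X₁)) + Av2 * X₀) / (4 / (1 * L)) ^ 2 +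
      (1 / (β * (L : ℝ) ^ 2)) ^ 2 * ((Real.sqrt 2 * ℓ) ^ 3 * X₃ + 3 * (Av1 * ((Real.sqrt 2 * ℓ) ^ 2 * X₂)) +
        3 * (Av2 * ((Real.sqrt 2 * ℓ) * X₁)) + κ₃F * ℓ ^ 3 / klScale e₀ m ^ 3 * X₀) / (4 / (1 * L)) ^ 3 := ⟨_, rfl⟩
  -- the core at this instance
  have hcore := hQ (L : ℝ) ((2 * M : ℕ) : ℝ) ε ℓ₁ ℓ Ae1 Ae2 An1 An2 Av1 Av2 X₀ X₁ X₂ X₃ Tt AΔ hL1 hM21 hε0 hε1 hΛm hΛ hβ hA0 hB0 hKp0 hwsi0 hρf0 hρm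
    hG₁0 hG₂0 hG₃0 hκ₃F0 hK₁0 hK₂0 hK₃0 hB₁0 hB₂0 hB₃0 hB₄0 hD0 hℓ₁ hℓ hAe1 hAe2 hAn1 hAn2 hAv1 hAv2 hX₀ hX₁ hX₂ hX₃ hTt hAΔ
  have hfin : Q * ((((2 * M : ℕ) : ℝ) + 1) / β) * ε ≤ 3 * Q * ((M : ℝ) / β) * ε := by
    have h := two_mul_add_one_div_le hMpos hβ
    calc Q * ((((2 * M : ℕ) : ℝ) + 1) / β) * ε ≤ Q * (3 * ((M : ℝ) / β)) * ε := by gcongr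
      _ = 3 * Q * ((M : ℝ) / β) * ε := by ring
  refine ⟨fun Y => ?_, fun Y' => ?_⟩
  · exact ((rowSum_sliceCT_sub_bgmFat_le B hA hADt he hz hz1 hgap h3 hlo hhi hβ hρA m hMm hd hd1 hd2 hd3 hA3 ha3 hB0 hB hB30 hB3 hΛ hΛΛ' hM'
      hK₁ hK₂ hK₃ hB₁ hB₂ hB₃ hB₄ hv₀ hv₁ hv₂ hv₃ hNr hLz hR₀ hℓ₁ hℓ hρf hG₁ hG₂ hG₃ hκ₃F hKp hwsi hτt hAe1 hAe2 hAn1 hAn2 hAv1 hAv2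
      hX₀ hX₁ hX₂ hX₃ hTt hs₀ one_pos one_pos one_pos one_pos hAΔ 0 hD hdom₀ hdom₁ Y).trans hcore).trans hfin
  · exact ((colSum_sliceCT_sub_bgmFat_le B hA hADt he hz hz1 hgap h3 hlo hhi hβ hρA m hMm hd hd1 hd2 hd3 hA3 ha3 hB0 hB hB30 hB3 hΛ hΛΛ' hM'
      hK₁ hK₂ hK₃ hB₁ hB₂ hB₃ hB₄ hv₀ hv₁ hv₂ hv₃ hNr hLz hR₀ hℓ₁ hℓ hρf hG₁ hG₂ hG₃ hκ₃F hKp hwsi hτt hAe1 hAe2 hAn1 hAn2 hAv1 hAv2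
      hX₀ hX₁ hX₂ hX₃ hTt hs₀ one_pos one_pos one_pos one_pos hAΔ 0 hD hdom₀ hdom₁ Y').trans hcore).trans hfin

end Frames


/-! ## §2 The entry sup of the defect: count × sup, free of `M` and of `L` -/

section Entry

open Classical

variable {a b : ℝ} (B : BandBounds a b) {A μ e₀ z β : ℝ} (hADt : 2 * A < B.Dtmin)
  (he : 0 < e₀) (hz : 0 < z) (hz1 : z ≤ 1) (hgap : e₀ + A + z ^ 2 < -μ) (h3 : e₀ + A - μ ≤ 3)
  (hlo : a ≤ μ - A - e₀) (hhi : μ + A + e₀ ≤ b) (hβ : 0 < β) (hρA : 4 * A < 2 * B.rhomin) (m : ℕ)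
  {d : ℝ} (hd : 0 ≤ d) (hd1 : ∀ u, |deriv (bgmCutoffSq e₀) u| ≤ d) (hd2 : ∀ u, |iteratedDeriv 2 (bgmCutoffSq e₀) u| ≤ d)
  {Λ Λ' : ℝ} (hΛ : 0 < Λ) (hΛΛ' : Λ ≤ Λ') {B₁ : ℝ} (hB₁ : ∀ x, |deriv salmhoferCutoff x| ≤ B₁)

include B hADt he hz hz1 hgap h3 hlo hhi hβ hρA hd hd1 hd2 hΛ hΛΛ' hB₁

/-- **Entry sup of the slice DEFECT, count × sup** (no rows, hence no grid density): for the fat family on the frame `K` and the band increment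
`|e_{K′} − e_K| ≤ P₀`, every entry of `S(F̃)ᵀ·(C^{K′}_{(Λ,Λ′]} − C^{K}_{(Λ,Λ′]})·S(F̃)` is at most `(βL²)⁻²·N_fat·((16B₁+16)·βL²/Λ²·P₀)`
(`norm_sectorSub_pullback_normalCovariance_le_of_count` with p3's `card_support_bgmFat_le` and the zeroth increment `norm_sliceSymbolFnXi_sub_le`).
[cite: BenfattoGiulianiMastropietro2006, §2.7 (2.66)–(2.67); §3 (3.3)] -/
theorem norm_sliceCT_sub_bgmFat_apply_le_of_incr {L M : ℕ} [NeZero L] [NeZero M] {K K' : TrigPolyC4v}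
    (hA : ∀ p : Momentum, ∀ j ≤ 2, ‖iteratedFDeriv ℝ j (frameShift K) p‖ ≤ A)
    {P₀ : ℝ} (hv₀ : ∀ p : Momentum, |frameLevel μ K' p - frameLevel μ K p| ≤ P₀) (Y Y' : SpaceTimeIdx L M × SectorLeg (sectorCount (m + 1))) :
    ‖((sectorSubMatrix L M β (bgmFatMultiplier L M e₀ β (nambuXiCT L μ K) (m + 1))).transpose *
            (hubbardCovSliceCT L M β μ 0 K' Λ Λ' - hubbardCovSliceCT L M β μ 0 K Λ Λ') *
            sectorSubMatrix L M β (bgmFatMultiplier L M e₀ β (nambuXiCT L μ K) (m + 1))) Y Y'‖ ≤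
      ‖((1 / (β * (L : ℝ) ^ 2) : ℝ) : ℂ)‖ ^ 2 * ((klScale e₀ m * β / π + 1) *
        ((Real.sqrt 2 * L * ((klScale e₀ m + (4 + 4 * A) *
            ((klScale e₀ m + B.smax * B.Dtmin * (3 * sectorWidth (m + 1) / 4)) / (B.Dtmin - 2 * A) +
              π * Real.sqrt 2 * (1 + (4 + 2 * A) / (B.Dtmin - 2 * A)) * sectorWidth (m + 1)) ^ 2) / (2 * B.rhomin - 4 * A)) / π + 2) *
          (Real.sqrt 2 * L * (2 * ((klScale e₀ m + B.smax * B.Dtmin * (3 * sectorWidth (m + 1) / 4)) / (B.Dtmin - 2 * A) +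
              π * Real.sqrt 2 * (1 + (4 + 2 * A) / (B.Dtmin - 2 * A)) * sectorWidth (m + 1))) / π + 2)) * ((16 * B₁ + 16) * (β * (L : ℝ) ^ 2) / Λ ^ 2 * P₀)) := by
  have hP₀ : 0 ≤ P₀ := (abs_nonneg _).trans (hv₀ 0)
  have hB₁0 : 0 ≤ B₁ := (abs_nonneg _).trans (hB₁ 0)
  have hc : 0 ≤ β * (L : ℝ) ^ 2 := by positivity
  rw [hubbardCovSliceCT_sub_eq_normalCovariance hβ.ne' μ K K' Λ Λ']
  refine norm_sectorSub_pullback_normalCovariance_le_of_count β (bgmFatMultiplier L M e₀ β (nambuXiCT L μ K) (m + 1))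
    (fun ω k => norm_bgmFatMultiplier_le_one e₀ β (nambuXiCT L μ K) (m + 1) ω k) _ (by positivity) (fun ks => ?_)
    (fun ω σ => le_trans ?_ (card_support_bgmFat_le (L := L) (M := M) B hA hADt he hz hz1 hgap h3 hlo hhi hβ hρA m hd hd1 hd2 ω)) Y Y'
  · -- the zeroth band increment of the slice symbol at this momentum
    have hθ : |(0 : ℝ)| ≤ Λ / 4 := by rw [abs_zero]; positivity
    have h := norm_sliceSymbolFnXi_sub_le (ω := matsubaraFreq β M ks.1.1) hΛ hΛΛ' hθ hc hB₁ (nambuXiCT L μ K ks.1.2)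
      (nambuXiCT L μ K' ks.1.2 - nambuXiCT L μ K ks.1.2)
    rw [add_sub_cancel] at h
    refine h.trans (mul_le_mul_of_nonneg_left ?_ (by positivity))
    rw [PerturbedFermiCurve.nambuXiCT_eq_frameLevel, PerturbedFermiCurve.nambuXiCT_eq_frameLevel]
    exact hv₀ _
  · exact_mod_cast Finset.card_le_card (fun k hk => by rw [mem_filter] at hk ⊢; exact ⟨hk.1, hk.2.1⟩)

/-- **THE ENTRY SUP OF THE SLICE-COVARIANCE FRAME DEFECT IS `O(ε)`, UNIFORMLY IN `(L, M, K, K′)`** — the `sE` of the response bracket: for the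
fixed one-volume data there is `C ≥ 0` with, for ALL `L, M ≥ 1`, all frames `K` of `C²` size `A`, all `K′`, every `ε` above `coeffNorm 0 (K′ ⊖ K)`:
`‖E Y Y′‖ ≤ C·ε` (no `M/β`: an entry carries no grid density). [cite: BenfattoGiulianiMastropietro2006, §2.7 (2.66)–(2.67); §3 (3.3)] -/
theorem exists_sliceDefect_entry_rate :
    ∃ C : ℝ, 0 ≤ C ∧ ∀ (L M : ℕ) [NeZero L] [NeZero M] (K K' : TrigPolyC4v),
      (∀ p : Momentum, ∀ j ≤ 2, ‖iteratedFDeriv ℝ j (frameShift K) p‖ ≤ A) →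
      ∀ ε : ℝ, (∀ j ≤ 3, (fsub K' K).coeffNorm j ≤ ε) →
        ∀ Y Y' : SpaceTimeIdx L M × SectorLeg (sectorCount (m + 1)), ‖((sectorSubMatrix L M β (bgmFatMultiplier L M e₀ β (nambuXiCT L μ K) (m + 1))).transpose *
            (hubbardCovSliceCT L M β μ 0 K' Λ Λ' - hubbardCovSliceCT L M β μ 0 K Λ Λ') *
            sectorSubMatrix L M β (bgmFatMultiplier L M e₀ β (nambuXiCT L μ K) (m + 1))) Y Y'‖ ≤ C * ε := by
  refine ⟨|((klScale e₀ m * β / π + 1) *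
        ((Real.sqrt 2 * ((klScale e₀ m + (4 + 4 * A) * ((klScale e₀ m + B.smax * B.Dtmin * (3 * sectorWidth (m + 1) / 4)) / (B.Dtmin - 2 * A) +
              π * Real.sqrt 2 * (1 + (4 + 2 * A) / (B.Dtmin - 2 * A)) * sectorWidth (m + 1)) ^ 2) / (2 * B.rhomin - 4 * A)) / π + 2) *
          (Real.sqrt 2 * (2 * ((klScale e₀ m + B.smax * B.Dtmin * (3 * sectorWidth (m + 1) / 4)) / (B.Dtmin - 2 * A) +
              π * Real.sqrt 2 * (1 + (4 + 2 * A) / (B.Dtmin - 2 * A)) * sectorWidth (m + 1))) / π + 2)))| * ((16 * B₁ + 16) / (β * Λ ^ 2)), ?_, ?_⟩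
  · have hB₁0 : 0 ≤ B₁ := (abs_nonneg _).trans (hB₁ 0)
    positivity
  intro L M _ _ K K' hA ε hε Y Y'
  have hL : (0 : ℝ) < L := Nat.cast_pos.2 (Nat.pos_of_ne_zero (NeZero.ne L))
  have hL1 : (1 : ℝ) ≤ L := by exact_mod_cast Nat.pos_of_ne_zero (NeZero.ne L)
  have hε0 : 0 ≤ ε := (TrigPolyC4v.coeffNorm_nonneg 0 _).trans (hε 0 (by norm_num))
  have hB₁0 : 0 ≤ B₁ := (abs_nonneg _).trans (hB₁ 0)
  have hA0 : 0 ≤ A := le_trans (norm_nonneg _) (hA 0 0 (by norm_num))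
  have hDt : 0 < B.Dtmin - 2 * A := by linarith
  have hρm : 0 < 2 * B.rhomin - 4 * A := by linarith
  have hΛm : 0 ≤ klScale e₀ m := by rw [klScale]; positivity
  have hρ0 : 0 ≤ ((klScale e₀ m + B.smax * B.Dtmin * (3 * sectorWidth (m + 1) / 4)) / (B.Dtmin - 2 * A) +
              π * Real.sqrt 2 * (1 + (4 + 2 * A) / (B.Dtmin - 2 * A)) * sectorWidth (m + 1)) := by
    have := B.smax_pos; have := B.Dtmin_pos; have := sectorWidth_pos (m + 1); positivity
  obtain ⟨hv₀, -, -, -⟩ := incrementData_of_coeffNorm' μ K K' (hε 0 (by norm_num)) (hε 1 (by norm_num)) (hε 2 (by norm_num)) (hε 3 (by norm_num))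
  refine (norm_sliceCT_sub_bgmFat_apply_le_of_incr B hADt he hz hz1 hgap h3 hlo hhi hβ hρA m hd hd1 hd2 hΛ hΛΛ' hB₁ hA hv₀ Y Y').trans ?_
  -- `N_fat ≤ L²·N₁` and the cancellation of `βL²`
  have hf : ∀ X : ℝ, 0 ≤ X → Real.sqrt 2 * L * X / π + 2 ≤ L * (Real.sqrt 2 * X / π + 2) := by
    intro X hX
    have h : (L : ℝ) * (Real.sqrt 2 * X / π + 2) - (Real.sqrt 2 * L * X / π + 2) = 2 * (L - 1) := by ring
    linarith
  have hX₁ : 0 ≤ (klScale e₀ m + (4 + 4 * A) * ((klScale e₀ m + B.smax * B.Dtmin * (3 * sectorWidth (m + 1) / 4)) / (B.Dtmin - 2 * A) +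
              π * Real.sqrt 2 * (1 + (4 + 2 * A) / (B.Dtmin - 2 * A)) * sectorWidth (m + 1)) ^ 2) / (2 * B.rhomin - 4 * A) := by positivity
  have h1 := hf _ hX₁
  have h2 := hf _ (by positivity : (0:ℝ) ≤ 2 * ((klScale e₀ m + B.smax * B.Dtmin * (3 * sectorWidth (m + 1) / 4)) / (B.Dtmin - 2 * A) +
              π * Real.sqrt 2 * (1 + (4 + 2 * A) / (B.Dtmin - 2 * A)) * sectorWidth (m + 1)))
  have hN : (klScale e₀ m * β / π + 1) *
        ((Real.sqrt 2 * L * ((klScale e₀ m + (4 + 4 * A) *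
            ((klScale e₀ m + B.smax * B.Dtmin * (3 * sectorWidth (m + 1) / 4)) / (B.Dtmin - 2 * A) +
              π * Real.sqrt 2 * (1 + (4 + 2 * A) / (B.Dtmin - 2 * A)) * sectorWidth (m + 1)) ^ 2) / (2 * B.rhomin - 4 * A)) / π + 2) *
          (Real.sqrt 2 * L * (2 * ((klScale e₀ m + B.smax * B.Dtmin * (3 * sectorWidth (m + 1) / 4)) / (B.Dtmin - 2 * A) +
              π * Real.sqrt 2 * (1 + (4 + 2 * A) / (B.Dtmin - 2 * A)) * sectorWidth (m + 1))) / π + 2)) ≤ (L : ℝ) ^ 2 * ((klScale e₀ m * β / π + 1) *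
        ((Real.sqrt 2 * ((klScale e₀ m + (4 + 4 * A) * ((klScale e₀ m + B.smax * B.Dtmin * (3 * sectorWidth (m + 1) / 4)) / (B.Dtmin - 2 * A) +
              π * Real.sqrt 2 * (1 + (4 + 2 * A) / (B.Dtmin - 2 * A)) * sectorWidth (m + 1)) ^ 2) / (2 * B.rhomin - 4 * A)) / π + 2) *
          (Real.sqrt 2 * (2 * ((klScale e₀ m + B.smax * B.Dtmin * (3 * sectorWidth (m + 1) / 4)) / (B.Dtmin - 2 * A) +
              π * Real.sqrt 2 * (1 + (4 + 2 * A) / (B.Dtmin - 2 * A)) * sectorWidth (m + 1))) / π + 2))) := by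
    calc _ ≤ (klScale e₀ m * β / π + 1) * ((L * (Real.sqrt 2 * ((klScale e₀ m + (4 + 4 * A) * ((klScale e₀ m + B.smax * B.Dtmin * (3 * sectorWidth (m + 1) / 4)) / (B.Dtmin - 2 * A) +
              π * Real.sqrt 2 * (1 + (4 + 2 * A) / (B.Dtmin - 2 * A)) * sectorWidth (m + 1)) ^ 2) / (2 * B.rhomin - 4 * A)) / π + 2)) *
          (L * (Real.sqrt 2 * (2 * ((klScale e₀ m + B.smax * B.Dtmin * (3 * sectorWidth (m + 1) / 4)) / (B.Dtmin - 2 * A) +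
              π * Real.sqrt 2 * (1 + (4 + 2 * A) / (B.Dtmin - 2 * A)) * sectorWidth (m + 1))) / π + 2))) := by gcongr
      _ = _ := by ring
  have hN1 : ((klScale e₀ m * β / π + 1) *
        ((Real.sqrt 2 * ((klScale e₀ m + (4 + 4 * A) * ((klScale e₀ m + B.smax * B.Dtmin * (3 * sectorWidth (m + 1) / 4)) / (B.Dtmin - 2 * A) +
              π * Real.sqrt 2 * (1 + (4 + 2 * A) / (B.Dtmin - 2 * A)) * sectorWidth (m + 1)) ^ 2) / (2 * B.rhomin - 4 * A)) / π + 2) *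
          (Real.sqrt 2 * (2 * ((klScale e₀ m + B.smax * B.Dtmin * (3 * sectorWidth (m + 1) / 4)) / (B.Dtmin - 2 * A) +
              π * Real.sqrt 2 * (1 + (4 + 2 * A) / (B.Dtmin - 2 * A)) * sectorWidth (m + 1))) / π + 2))) ≤ |((klScale e₀ m * β / π + 1) *
        ((Real.sqrt 2 * ((klScale e₀ m + (4 + 4 * A) * ((klScale e₀ m + B.smax * B.Dtmin * (3 * sectorWidth (m + 1) / 4)) / (B.Dtmin - 2 * A) +
              π * Real.sqrt 2 * (1 + (4 + 2 * A) / (B.Dtmin - 2 * A)) * sectorWidth (m + 1)) ^ 2) / (2 * B.rhomin - 4 * A)) / π + 2) *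
          (Real.sqrt 2 * (2 * ((klScale e₀ m + B.smax * B.Dtmin * (3 * sectorWidth (m + 1) / 4)) / (B.Dtmin - 2 * A) +
              π * Real.sqrt 2 * (1 + (4 + 2 * A) / (B.Dtmin - 2 * A)) * sectorWidth (m + 1))) / π + 2)))| := le_abs_self _
  have hnc : ‖((1 / (β * (L : ℝ) ^ 2) : ℝ) : ℂ)‖ ^ 2 = (1 / (β * (L : ℝ) ^ 2)) ^ 2 := by
    rw [Complex.norm_real, Real.norm_eq_abs, abs_of_nonneg (by positivity)]
  rw [hnc]
  have hN' : (klScale e₀ m * β / π + 1) *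
        ((Real.sqrt 2 * L * ((klScale e₀ m + (4 + 4 * A) *
            ((klScale e₀ m + B.smax * B.Dtmin * (3 * sectorWidth (m + 1) / 4)) / (B.Dtmin - 2 * A) +
              π * Real.sqrt 2 * (1 + (4 + 2 * A) / (B.Dtmin - 2 * A)) * sectorWidth (m + 1)) ^ 2) / (2 * B.rhomin - 4 * A)) / π + 2) *
          (Real.sqrt 2 * L * (2 * ((klScale e₀ m + B.smax * B.Dtmin * (3 * sectorWidth (m + 1) / 4)) / (B.Dtmin - 2 * A) +
              π * Real.sqrt 2 * (1 + (4 + 2 * A) / (B.Dtmin - 2 * A)) * sectorWidth (m + 1))) / π + 2)) ≤ (L : ℝ) ^ 2 * |((klScale e₀ m * β / π + 1) *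
        ((Real.sqrt 2 * ((klScale e₀ m + (4 + 4 * A) * ((klScale e₀ m + B.smax * B.Dtmin * (3 * sectorWidth (m + 1) / 4)) / (B.Dtmin - 2 * A) +
              π * Real.sqrt 2 * (1 + (4 + 2 * A) / (B.Dtmin - 2 * A)) * sectorWidth (m + 1)) ^ 2) / (2 * B.rhomin - 4 * A)) / π + 2) *
          (Real.sqrt 2 * (2 * ((klScale e₀ m + B.smax * B.Dtmin * (3 * sectorWidth (m + 1) / 4)) / (B.Dtmin - 2 * A) +
              π * Real.sqrt 2 * (1 + (4 + 2 * A) / (B.Dtmin - 2 * A)) * sectorWidth (m + 1))) / π + 2)))| := hN.trans (mul_le_mul_of_nonneg_left hN1 (by positivity))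
  have hP0 : 0 ≤ (16 * B₁ + 16) * (β * (L : ℝ) ^ 2) / Λ ^ 2 * ε := by positivity
  calc (1 / (β * (L : ℝ) ^ 2)) ^ 2 * ((klScale e₀ m * β / π + 1) *
        ((Real.sqrt 2 * L * ((klScale e₀ m + (4 + 4 * A) *
            ((klScale e₀ m + B.smax * B.Dtmin * (3 * sectorWidth (m + 1) / 4)) / (B.Dtmin - 2 * A) +
              π * Real.sqrt 2 * (1 + (4 + 2 * A) / (B.Dtmin - 2 * A)) * sectorWidth (m + 1)) ^ 2) / (2 * B.rhomin - 4 * A)) / π + 2) *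
          (Real.sqrt 2 * L * (2 * ((klScale e₀ m + B.smax * B.Dtmin * (3 * sectorWidth (m + 1) / 4)) / (B.Dtmin - 2 * A) +
              π * Real.sqrt 2 * (1 + (4 + 2 * A) / (B.Dtmin - 2 * A)) * sectorWidth (m + 1))) / π + 2)) * ((16 * B₁ + 16) * (β * (L : ℝ) ^ 2) / Λ ^ 2 * ε))
      ≤ (1 / (β * (L : ℝ) ^ 2)) ^ 2 * (((L : ℝ) ^ 2 * |((klScale e₀ m * β / π + 1) *
        ((Real.sqrt 2 * ((klScale e₀ m + (4 + 4 * A) * ((klScale e₀ m + B.smax * B.Dtmin * (3 * sectorWidth (m + 1) / 4)) / (B.Dtmin - 2 * A) +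
              π * Real.sqrt 2 * (1 + (4 + 2 * A) / (B.Dtmin - 2 * A)) * sectorWidth (m + 1)) ^ 2) / (2 * B.rhomin - 4 * A)) / π + 2) *
          (Real.sqrt 2 * (2 * ((klScale e₀ m + B.smax * B.Dtmin * (3 * sectorWidth (m + 1) / 4)) / (B.Dtmin - 2 * A) +
              π * Real.sqrt 2 * (1 + (4 + 2 * A) / (B.Dtmin - 2 * A)) * sectorWidth (m + 1))) / π + 2)))|) * ((16 * B₁ + 16) * (β * (L : ℝ) ^ 2) / Λ ^ 2 * ε)) :=
        mul_le_mul_of_nonneg_left (mul_le_mul_of_nonneg_right hN' hP0) (by positivity)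
    _ = |((klScale e₀ m * β / π + 1) *
        ((Real.sqrt 2 * ((klScale e₀ m + (4 + 4 * A) * ((klScale e₀ m + B.smax * B.Dtmin * (3 * sectorWidth (m + 1) / 4)) / (B.Dtmin - 2 * A) +
              π * Real.sqrt 2 * (1 + (4 + 2 * A) / (B.Dtmin - 2 * A)) * sectorWidth (m + 1)) ^ 2) / (2 * B.rhomin - 4 * A)) / π + 2) *
          (Real.sqrt 2 * (2 * ((klScale e₀ m + B.smax * B.Dtmin * (3 * sectorWidth (m + 1) / 4)) / (B.Dtmin - 2 * A) +
              π * Real.sqrt 2 * (1 + (4 + 2 * A) / (B.Dtmin - 2 * A)) * sectorWidth (m + 1))) / π + 2)))| * ((16 * B₁ + 16) / (β * Λ ^ 2)) * ε := by field_simp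

end Entry

end Summit.HubbardSuperconductivity.HubbardSuperconductivity.Theorems.TorusFourierL2

end
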